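import Mathlib

/-!
# Route `TropicalKugaSatakeCayley`, support S5 `CayleyHodgeRankTwo` (stmt-HodgeConjecture-18573) — part B0:
# the derivation of an alternating form is an alternating form; vanishing test on increasing basis words

Generic multilinear algebra used by the certified cusp computation (part B): for a continuous alternating
form `c` on a real normed space `V` and a linear operator `N`,

* `tkc_exists_derivAlternating` — the slotwise derivation `u ↦ Σₘ c(u₁, …, N uₘ, …, u_k)` IS (the
  coercion of) an alternating map `D : V [⋀^Fin k]→ₗ[ℝ] ℂ` (sum over `m` of `c` precomposed with `N` in
  slot `m`; alternating because the two surviving terms at a coincidence `uᵢ = uⱼ` are exchanged by the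
  transposition `(i j)`);
* `tkc_alternating_apply_eq_zero_of_range_subset` — an alternating map vanishing on a tuple vanishes on
  every injective tuple with the same set of entries (`AlternatingMap.map_perm`);
* `tkc_alternating_eq_zero_of_strictMono` — **an alternating map on a space with a finite basis indexed by
  a linear order vanishes as soon as it vanishes on the INCREASING words of basis vectors**
  (`Module.Basis.ext_alternating` + sorting the word, `Finset.orderEmbOfFin`).

So `D_N c = 0` — the hypothesis format of the flatness criterion (part A3) — reduces to finitely many
evaluations of `c` on basis words, which part B discharges by a kernel computation on the coefficient
table of an explicit form. Theorems only: no definition, no named fact, no sorry.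

## References

* [LangeBirkenhake1992] H. Lange, Ch. Birkenhake, Complex Abelian Varieties (1992), §1.1.3 (the monomial
  basis of `Altᵏ`).
* N. Bourbaki, Algèbre, Ch. III §7 (alternating multilinear maps; derivations of the exterior algebra).
-/

noncomputable section

set_option linter.dupNamespace false

namespace Summit.HodgeConjecture.HodgeConjecture.Theorems

section DerivationForm

variable {V : Type*} [NormedAddCommGroup V] [NormedSpace ℝ V] {k : ℕ}

/-- **The derivation of an alternating form along a linear operator is an alternating form**: there is
an alternating map `D` with `D u = Σₘ c(u₁, …, N uₘ, …, u_k)` for all `u`. [folklore] -/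
theorem tkc_exists_derivAlternating (c : V [⋀^Fin k]→L[ℝ] ℂ) (N : V →ₗ[ℝ] V) :
    ∃ D : V [⋀^Fin k]→ₗ[ℝ] ℂ, ∀ u : Fin k → V, D u = ∑ m, c (Function.update u m (N (u m))) := by
  classical
  -- the multilinear map `Σ_m c ∘ (N in slot m)`
  let Mm : Fin k → MultilinearMap ℝ (fun _ : Fin k => V) ℂ := fun m =>
    c.toContinuousMultilinearMap.toMultilinearMap.compLinearMap
      (fun i => Function.update (fun _ : Fin k => (LinearMap.id : V →ₗ[ℝ] V)) m N i)
  have hMm : ∀ m u, Mm m u = c (Function.update u m (N (u m))) := by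
    intro m u
    simp only [Mm, MultilinearMap.compLinearMap_apply, ContinuousMultilinearMap.coe_coe,
      ContinuousAlternatingMap.coe_toContinuousMultilinearMap]
    congr 1
    funext i
    by_cases hi : i = m
    · subst hi
      simp
    · simp [Function.update_of_ne hi]
  let M : MultilinearMap ℝ (fun _ : Fin k => V) ℂ := ∑ m, Mm m
  have hM : ∀ u, M u = ∑ m, c (Function.update u m (N (u m))) := by
    intro u
    simp only [M, _root_.sum_apply, hMm]
  refine ⟨{ M with
    map_eq_zero_of_eq' := ?_ }, fun u => hM u⟩
  intro u i j hij hne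
  change M u = 0
  rw [hM]
  -- split off the terms `m = i` and `m = j`; the others vanish (two equal entries survive)
  have hrest : ∀ m, m ≠ i → m ≠ j → c (Function.update u m (N (u m))) = 0 := by
    intro m hmi hmj
    exact c.map_eq_zero_of_eq (Function.update u m (N (u m)))
      (by rw [Function.update_of_ne (Ne.symm hmi), Function.update_of_ne (Ne.symm hmj), hij]) hne
  rw [← Finset.add_sum_erase _ _ (Finset.mem_univ i),
    ← Finset.add_sum_erase _ _ (Finset.mem_erase.2 ⟨hne.symm, Finset.mem_univ j⟩)]
  have hzero : ∑ m ∈ (Finset.univ.erase i).erase j, c (Function.update u m (N (u m))) = 0 := by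
    refine Finset.sum_eq_zero fun m hm => ?_
    simp only [Finset.mem_erase, Finset.mem_univ, and_true] at hm
    exact hrest m hm.2 hm.1
  rw [hzero, add_zero]
  -- the two surviving terms are exchanged by the transposition `(i j)`
  have hswap : Function.update u j (N (u j)) = Function.update u i (N (u i)) ∘ Equiv.swap i j := by
    funext m
    simp only [Function.comp_apply]
    by_cases hmi : m = i
    · subst hmi
      rw [Equiv.swap_apply_left, Function.update_of_ne hne, Function.update_of_ne (Ne.symm hne), hij]
    · by_cases hmj : m = j
      · subst hmj
        rw [Equiv.swap_apply_right, Function.update_self, Function.update_self, hij]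
      · rw [Equiv.swap_apply_of_ne_of_ne hmi hmj, Function.update_of_ne hmj, Function.update_of_ne hmi]
  rw [hswap, ← ContinuousAlternatingMap.coe_toAlternatingMap, AlternatingMap.map_swap _ _ hne,
    ContinuousAlternatingMap.coe_toAlternatingMap, add_neg_cancel]

/-- **An alternating map vanishing on a tuple vanishes on every injective tuple with the same (or smaller)
set of entries** (`AlternatingMap` version of `ktks_apply_eq_zero_of_range_subset`). [folklore] -/
theorem tkc_alternating_apply_eq_zero_of_range_subset {n : ℕ} (f : V [⋀^Fin n]→ₗ[ℝ] ℂ) {u u' : Fin n → V}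
    (hu' : Function.Injective u') (h : Set.range u' ⊆ Set.range u) (h0 : f u = 0) : f u' = 0 := by
  classical
  have hex : ∀ i, ∃ j, u j = u' i := fun i => h ⟨i, rfl⟩
  choose g hg using hex
  have hginj : Function.Injective g := by
    intro i i' hii'
    apply hu'
    rw [← hg i, ← hg i', hii']
  have hgbij : Function.Bijective g := Finite.injective_iff_bijective.1 hginj
  have hu'eq : u' = u ∘ (Equiv.ofBijective g hgbij) := by
    funext i
    simp only [Function.comp_apply, Equiv.ofBijective_apply, hg]
  rw [hu'eq, f.map_perm u (Equiv.ofBijective g hgbij), h0, smul_zero]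

/-- **Vanishing test on increasing basis words.** An alternating map on a module with a finite basis `b`
indexed by a linear order is zero as soon as it vanishes on all tuples `(b (v 0), …, b (v (n-1)))` with
`v` strictly increasing. [cite: LangeBirkenhake1992, §1.1.3] -/
theorem tkc_alternating_eq_zero_of_strictMono {ι : Type*} [Fintype ι] [LinearOrder ι] {n : ℕ}
    (b : Module.Basis ι ℝ V) (f : V [⋀^Fin n]→ₗ[ℝ] ℂ)
    (h : ∀ v : Fin n → ι, StrictMono v → f (fun i => b (v i)) = 0) : f = 0 := by
  classical
  refine Module.Basis.ext_alternating b fun v hv => ?_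
  rw [AlternatingMap.zero_apply]
  -- sort the word
  set s : Finset ι := Finset.univ.image v with hs
  have hcard : s.card = n := by
    rw [hs, Finset.card_image_of_injective _ hv, Finset.card_univ, Fintype.card_fin]
  set w : Fin n → ι := fun i => s.orderEmbOfFin hcard i with hw
  have hwmono : StrictMono w := fun i j hij => (s.orderEmbOfFin hcard).strictMono hij
  have hrange : Set.range (fun i => b (v i)) ⊆ Set.range (fun i => b (w i)) := by
    rintro _ ⟨i, rfl⟩
    have hvi : v i ∈ s := Finset.mem_image_of_mem v (Finset.mem_univ i)
    have hvi' : v i ∈ Set.range (s.orderEmbOfFin hcard) := by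
      rw [Finset.range_orderEmbOfFin]
      exact hvi
    obtain ⟨j, hj⟩ := hvi'
    exact ⟨j, by simp only [hw, hj]⟩
  exact tkc_alternating_apply_eq_zero_of_range_subset f (b.injective.comp hv) hrange (h w hwmono)

/-- **Vanishing test for derivations on increasing basis words**: if
`Σₘ c(b_{v 0}, …, N b_{v m}, …, b_{v (k-1)}) = 0` for every strictly increasing word `v`, then
`D_N c = 0` identically. [folklore] -/
theorem tkc_deriv_eq_zero_of_strictMono {ι : Type*} [Fintype ι] [LinearOrder ι]
    (b : Module.Basis ι ℝ V) (c : V [⋀^Fin k]→L[ℝ] ℂ) (N : V →ₗ[ℝ] V)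
    (h : ∀ v : Fin k → ι, StrictMono v →
      ∑ m, c (Function.update (fun i => b (v i)) m (N (b (v m)))) = 0)
    (u : Fin k → V) : ∑ m, c (Function.update u m (N (u m))) = 0 := by
  obtain ⟨D, hD⟩ := tkc_exists_derivAlternating c N
  have hD0 : D = 0 :=
    tkc_alternating_eq_zero_of_strictMono b D fun v hv => by rw [hD]; exact h v hv
  rw [← hD, hD0, AlternatingMap.zero_apply]

end DerivationForm

end Summit.HodgeConjecture.HodgeConjecture.Theorems

end
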